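import Literature.NumberTheory.LFunctions.SmoothedExplicitFormulaKadiri
import Literature.NumberTheory.LFunctions.KadiriGammaRemainder
import Literature.NumberTheory.LFunctions.FordZetaZeroRecipSqSum
import HarnessLib

/-!
# Kadiri's explicit formula at the shifted point `s + δ` (Acta Arith. 117 (2005), Prop. 2.1 applied to `T₂(s+δ)`, `Δ₁ = T₁(s) − κT₁(s+δ)`)

Topic `Literature/NumberTheory/LFunctions`. Everything in this file is PROVED (no named fact); one
auxiliary definition (`expTwist f δ`, the test function `t ↦ f(t)e^{−δt}`). The tree's smoothed
explicit formula in Kadiri's form (`SmoothedEF.re_fordK_eq_kadiri`) is proved for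
`1/2 < Re s < 3/2` (the right edge of the contour being `Re w = 3/2`), whereas Kadiri's method
applies it also at `s + δ` with `δ ≈ 0.62`, `Re(s+δ) ≈ 1.6`. We transport the formula to
`s + δ` as follows.

* `expTwist f δ` is again an admissible smoothing (`IsSmoothedEFTest.expTwist`), with
  `K_{f_δ}(s) = K_f(s+δ)` (`fordK_expTwist`) and `F_{f_δ}(z) = F_f(z+δ)` (`fordLaplace_expTwist`),
  `F₀^{f_δ}(z) = F₀^f(z+δ) + f(0)(1/(z+δ) − 1/z)`.
* Hence Prop. 2.1 for `f_δ` at `s` expands `Re K_f(s+δ)`, with the `Γ`-term at `s` and the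
  remainder `T₂^{f_δ}(s) = T₂^f(s+δ) + f(0) Re G_δ(s)`,
  `G_δ(s) = (1/(s+δ) − 1/s) + (1/2π)∫ Re ψ((1/2+iy)/2) (1/(s+δ−w_y) − 1/(s−w_y)) dy`, `w_y = 1/2+iy`
  (second part of the file);
* the pure digamma identity `Re G_δ(s) = ½[Re ψ((s+δ)/2+1) − Re ψ(s/2+1)]` on `Re s > 1/2`,
  obtained on the strip `1/2 < Re s < 3/2 − δ` by comparing the two expansions and extended by
  analyticity (open mapping and identity theorems), converts the `Γ`-term at `s` into Kadiri's
  `Γ`-term at `s + δ` (third part).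

## References

* H. Kadiri, *Une région explicite sans zéros pour la fonction ζ de Riemann*, Acta Arith. 117
  (2005) = arXiv:math/0401238, Prop. 2.1, §2.3 (`Δ₁`, `Δ₂` at `s` and `s + δ`). (`Kadiri2005`)
-/

noncomputable section

open Complex Real MeasureTheory Set Filter Topology

namespace Literature.NumberTheory.LFunctions

/-- The exponentially twisted test function `f_δ(t) = f(t) e^{−δt}`: `K_{f_δ}(s) = K_f(s + δ)`.
[cite: Kadiri2005, §2.3] -/
def expTwist (f : ℝ → ℝ) (δ : ℝ) (t : ℝ) : ℝ := f t * Real.exp (-(δ * t))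

namespace SmoothedEF

variable {f p p' p'' : ℝ → ℝ} {x₀ : ℝ}

/-! ## The twisted test function is admissible -/

/-- `f_δ(0) = f(0)`. [folklore] -/
theorem expTwist_zero (f : ℝ → ℝ) (δ : ℝ) : expTwist f δ 0 = f 0 := by simp [expTwist]

/-- **`f_δ` is an admissible smoothing** with profile `p e^{−δt}` (and the derivatives given by the
product rule). [folklore] -/
theorem _root_.Literature.NumberTheory.LFunctions.IsSmoothedEFTest.expTwist
    (h : IsSmoothedEFTest f p p' p'' x₀) (δ : ℝ) :
    IsSmoothedEFTest (expTwist f δ) (fun t ↦ p t * Real.exp (-(δ * t)))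
      (fun t ↦ (p' t - δ * p t) * Real.exp (-(δ * t)))
      (fun t ↦ (p'' t - 2 * δ * p' t + δ ^ 2 * p t) * Real.exp (-(δ * t))) x₀ where
  cont := h.cont.mul (by fun_prop)
  x₀_nonneg := h.x₀_nonneg
  eqOn := fun t ht ↦ by simp [_root_.Literature.NumberTheory.LFunctions.expTwist, h.eqOn t ht]
  eq_zero := fun u hu ↦ by simp [_root_.Literature.NumberTheory.LFunctions.expTwist, h.eq_zero u hu]
  hasDerivAt := fun t ↦ by
    have he : HasDerivAt (fun t : ℝ ↦ Real.exp (-(δ * t))) (-δ * Real.exp (-(δ * t))) t := by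
      have h1 : HasDerivAt (fun t : ℝ ↦ -(δ * t)) (-δ) t := by
        simpa using (hasDerivAt_id t).const_mul (-δ)
      convert h1.exp using 1
      ring
    exact ((h.hasDerivAt t).mul he).congr_deriv (by ring)
  hasDerivAt' := fun t ↦ by
    have he : HasDerivAt (fun t : ℝ ↦ Real.exp (-(δ * t))) (-δ * Real.exp (-(δ * t))) t := by
      have h1 : HasDerivAt (fun t : ℝ ↦ -(δ * t)) (-δ) t := by
        simpa using (hasDerivAt_id t).const_mul (-δ)
      convert h1.exp using 1
      ring
    have hp : HasDerivAt (fun t ↦ p' t - δ * p t) (p'' t - δ * p' t) t :=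
      (h.hasDerivAt' t).sub ((h.hasDerivAt t).const_mul δ)
    exact (hp.mul he).congr_deriv (by ring)
  cont'' := by
    have h1 := h.cont''
    have h2 : Continuous p' := continuous_iff_continuousAt.2 fun t ↦ (h.hasDerivAt' t).continuousAt
    have h3 : Continuous p := continuous_iff_continuousAt.2 fun t ↦ (h.hasDerivAt t).continuousAt
    fun_prop
  p_x₀ := by simp [h.p_x₀]
  p'_x₀ := by simp [h.p_x₀, h.p'_x₀]

/-! ## Transport of `K`, `F`, `F₀` -/

/-- **`K_{f_δ}(s) = K_f(s + δ)`**: `f(log n) e^{−δ log n} n^{−s} = f(log n) n^{−(s+δ)}`.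
[cite: Kadiri2005, §2.3] -/
theorem fordK_expTwist (f : ℝ → ℝ) (δ : ℝ) (s : ℂ) :
    fordK (expTwist f δ) s = fordK f (s + δ) := by
  unfold fordK
  refine tsum_congr fun n ↦ ?_
  rcases Nat.eq_zero_or_pos n with rfl | hn
  · simp
  have hnR : (0 : ℝ) < n := by exact_mod_cast hn
  have hnC : (n : ℂ) ≠ 0 := by exact_mod_cast hn.ne'
  simp only [_root_.Literature.NumberTheory.LFunctions.expTwist]
  have h1 : Real.exp (-(δ * Real.log n)) = (n : ℝ) ^ (-δ) := by
    rw [Real.rpow_def_of_pos hnR]; ring_nf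
  rw [h1]
  have h2 : (((n : ℝ) ^ (-δ) : ℝ) : ℂ) = (n : ℂ) ^ (-(δ : ℂ)) := by
    rw [Complex.ofReal_cpow hnR.le]; simp
  push_cast
  rw [h2, neg_add, Complex.cpow_add _ _ hnC]
  ring

/-- **`F_{f_δ}(z) = F_f(z + δ)`**. [cite: Kadiri2005, §2.3] -/
theorem fordLaplace_expTwist (f : ℝ → ℝ) (δ : ℝ) (z : ℂ) :
    fordLaplace (expTwist f δ) z = fordLaplace f (z + δ) := by
  unfold fordLaplace
  refine setIntegral_congr_fun measurableSet_Ioi fun u _ ↦ ?_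
  simp only [_root_.Literature.NumberTheory.LFunctions.expTwist]
  push_cast
  rw [show -((z + δ) * u) = -(z * u) + -((δ : ℂ) * u) by ring, Complex.exp_add]
  ring

/-- **`F₀^{f_δ}(z) = F₀^f(z + δ) + f(0)(1/(z+δ) − 1/z)`**. [cite: Kadiri2005, §2.3] -/
theorem fordLaplace₀_expTwist (f : ℝ → ℝ) (δ : ℝ) (z : ℂ) :
    fordLaplace₀ (expTwist f δ) z = fordLaplace₀ f (z + δ) + (f 0 : ℂ) * (1 / (z + δ) - 1 / z) := by
  unfold fordLaplace₀
  rw [fordLaplace_expTwist, expTwist_zero]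
  ring

/-! ## The correction `G_δ(s)` and the decomposition of the `Γ`-remainder -/

/-- The correction term
`G_δ(s) = (1/(s+δ) − 1/s) + (1/2π) ∫ Re ψ((1/2+iy)/2) · (1/(s+δ−w_y) − 1/(s−w_y)) dy`,
`w_y = 1/2 + iy`, by which the `Γ`-remainders of the expansions of `K_{f_δ}(s)` and `K_f(s+δ)`
differ (per unit of `f(0)`). [cite: Kadiri2005, §2.3] -/
def shiftG (δ : ℝ) (s : ℂ) : ℂ :=
  (1 / (s + δ) - 1 / s) + (1 / (2 * π) : ℂ) *
    ∫ y : ℝ, ((digamma (((((1 / 2 : ℝ)) : ℂ) + y * I) / 2)).re : ℂ) *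
      (1 / (s + δ - ((((1 / 2 : ℝ)) : ℂ) + y * I)) - 1 / (s - ((((1 / 2 : ℝ)) : ℂ) + y * I)))

/-- `|1/(s+δ−w_y) − 1/(s−w_y)| ≤ δ/((Re s − 1/2)² + (Im s − y)²)` for `Re s > 1/2`, `δ ≥ 0`
(`|s + δ − w_y| ≥ |s − w_y|`). [folklore] -/
theorem norm_inv_sub_inv_le {δ : ℝ} (hδ : 0 ≤ δ) {s : ℂ} (hs : 1 / 2 < s.re) (y : ℝ) :
    ‖1 / (s + δ - ((((1 / 2 : ℝ)) : ℂ) + y * I)) - 1 / (s - ((((1 / 2 : ℝ)) : ℂ) + y * I))‖ ≤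
      δ / ((s.re - 1 / 2) ^ 2 + (s.im - y) ^ 2) := by
  set w : ℂ := (((1 / 2 : ℝ)) : ℂ) + y * I with hw
  set z : ℂ := s - w with hz
  have hzre : z.re = s.re - 1 / 2 := by simp [hz, hw]
  have hzim : z.im = s.im - y := by simp [hz, hw]
  have hz2 : ‖z‖ ^ 2 = (s.re - 1 / 2) ^ 2 + (s.im - y) ^ 2 := by
    rw [Complex.sq_norm, Complex.normSq_apply, hzre, hzim]; ring
  have hq : 0 < (s.re - 1 / 2) ^ 2 + (s.im - y) ^ 2 := by nlinarith
  have hzn : 0 < ‖z‖ := by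
    by_contra h
    have h0 : ‖z‖ = 0 := le_antisymm (not_lt.1 h) (norm_nonneg _)
    rw [h0] at hz2; simp at hz2; linarith
  have hz0 : z ≠ 0 := norm_pos_iff.1 hzn
  have hzd2 : ‖z‖ ^ 2 ≤ ‖z + δ‖ ^ 2 := by
    rw [Complex.sq_norm, Complex.sq_norm, Complex.normSq_apply, Complex.normSq_apply,
      Complex.add_re, Complex.add_im, hzre, hzim]
    simp
    nlinarith
  have hzdn : ‖z‖ ≤ ‖z + δ‖ := by
    have := Real.sqrt_le_sqrt hzd2
    rwa [Real.sqrt_sq (norm_nonneg _), Real.sqrt_sq (norm_nonneg _)] at this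
  have hzd : z + δ ≠ 0 := norm_pos_iff.1 (hzn.trans_le hzdn)
  have e : s + δ - w = z + δ := by rw [hz]; ring
  rw [e, div_sub_div _ _ hzd hz0, norm_div, norm_mul]
  have e2 : (1 : ℂ) * z - (z + δ) * 1 = -(δ : ℂ) := by ring
  rw [e2, norm_neg, Complex.norm_real, Real.norm_eq_abs, abs_of_nonneg hδ, ← hz2]
  rw [div_le_div_iff₀ (by positivity) (by positivity)]
  calc δ * ‖z‖ ^ 2 = δ * (‖z‖ * ‖z‖) := by ring
    _ ≤ δ * (‖z + δ‖ * ‖z‖) := by gcongr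

/-- The integrand of `G_δ` is integrable (`Re s > 1/2`, `δ ≥ 0`): it is
`O((log(3+|y|) + 12) · δ/((Re s − ½)² + (Im s − y)²))`. [folklore] -/
theorem integrable_shiftG_integrand {δ : ℝ} (hδ : 0 ≤ δ) {s : ℂ} (hs : 1 / 2 < s.re) :
    Integrable fun y : ℝ ↦ ((digamma (((((1 / 2 : ℝ)) : ℂ) + y * I) / 2)).re : ℂ) *
      (1 / (s + δ - ((((1 / 2 : ℝ)) : ℂ) + y * I)) - 1 / (s - ((((1 / 2 : ℝ)) : ℂ) + y * I))) := by
  have hmaj := KadiriGamma.integrable_T2_majorant (a := s.re - 1 / 2) (t := s.im) (A := 12) (B := δ)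
    (by linarith) (by norm_num) hδ
  refine hmaj.mono' ?_ (ae_of_all _ fun y ↦ ?_)
  · refine (Continuous.mul ?_ ?_).aestronglyMeasurable
    · refine Complex.continuous_ofReal.comp (Complex.continuous_re.comp ?_)
      set g : ℝ → ℂ := fun y ↦ ((((1 / 2 : ℝ)) : ℂ) + y * I) / 2 with hg
      have hgc : Continuous g := by rw [hg]; fun_prop
      have e : (fun y : ℝ ↦ digamma (((((1 / 2 : ℝ)) : ℂ) + y * I) / 2)) = digamma ∘ g := rfl
      rw [e]
      refine continuous_iff_continuousAt.2 fun y ↦ ?_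
      exact (differentiableAt_digamma (z := g y) (by simp [hg])).continuousAt.comp hgc.continuousAt
    · refine continuous_iff_continuousAt.2 fun y ↦ ?_
      have h1 : s + δ - ((((1 / 2 : ℝ)) : ℂ) + y * I) ≠ 0 := fun e ↦ by
        have := congrArg Complex.re e; simp at this; linarith
      have h2 : s - ((((1 / 2 : ℝ)) : ℂ) + y * I) ≠ 0 := fun e ↦ by
        have := congrArg Complex.re e; simp at this; linarith
      refine ContinuousAt.sub ?_ ?_
      · exact (continuousAt_const.div (by fun_prop) h1)
      · exact (continuousAt_const.div (by fun_prop) h2)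
  · rw [norm_mul, Complex.norm_real, Real.norm_eq_abs]
    exact mul_le_mul (KadiriGamma.abs_re_digamma_le y) (norm_inv_sub_inv_le hδ hs y)
      (norm_nonneg _) (by have := Real.log_nonneg (by linarith [abs_nonneg y] : (1:ℝ) ≤ 3 + |y|); linarith)

/-- **Decomposition of the `Γ`-remainder of `f_δ`**: for `Re s > 1/2`,
`F₀^{f_δ}(s) + (1/2π)∫ Re ψ · F₀^{f_δ}(s − w_y) dy
   = [F₀^f(s+δ) + (1/2π)∫ Re ψ · F₀^f(s+δ − w_y) dy] + f(0) · G_δ(s)`. [cite: Kadiri2005, §2.3] -/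
theorem T2_expTwist (h : IsSmoothedEFTest f p p' p'' x₀) {δ : ℝ} (hδ : 0 ≤ δ) {s : ℂ}
    (hs : 1 / 2 < s.re) :
    fordLaplace₀ (expTwist f δ) s + (1 / (2 * π) : ℂ) *
        ∫ y : ℝ, ((digamma (((((1 / 2 : ℝ)) : ℂ) + y * I) / 2)).re : ℂ) *
          fordLaplace₀ (expTwist f δ) (s - ((((1 / 2 : ℝ)) : ℂ) + y * I)) =
      (fordLaplace₀ f (s + δ) + (1 / (2 * π) : ℂ) *
        ∫ y : ℝ, ((digamma (((((1 / 2 : ℝ)) : ℂ) + y * I) / 2)).re : ℂ) *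
          fordLaplace₀ f ((s + δ) - ((((1 / 2 : ℝ)) : ℂ) + y * I))) +
      (f 0 : ℂ) * shiftG δ s := by
  -- pointwise decomposition of the integrand
  have hpt : ∀ y : ℝ, ((digamma (((((1 / 2 : ℝ)) : ℂ) + y * I) / 2)).re : ℂ) *
        fordLaplace₀ (expTwist f δ) (s - ((((1 / 2 : ℝ)) : ℂ) + y * I)) =
      ((digamma (((((1 / 2 : ℝ)) : ℂ) + y * I) / 2)).re : ℂ) *
          fordLaplace₀ f ((s + δ) - ((((1 / 2 : ℝ)) : ℂ) + y * I)) +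
        (f 0 : ℂ) * (((digamma (((((1 / 2 : ℝ)) : ℂ) + y * I) / 2)).re : ℂ) *
          (1 / (s + δ - ((((1 / 2 : ℝ)) : ℂ) + y * I)) - 1 / (s - ((((1 / 2 : ℝ)) : ℂ) + y * I)))) := by
    intro y
    rw [fordLaplace₀_expTwist, show s - ((((1 / 2 : ℝ)) : ℂ) + y * I) + δ =
      s + δ - ((((1 / 2 : ℝ)) : ℂ) + y * I) by ring]
    ring
  -- integrability of the two pieces
  have hsδ : 1 / 2 < (s + δ).re := by simp; linarith
  have hint1 : Integrable fun y : ℝ ↦ ((digamma (((((1 / 2 : ℝ)) : ℂ) + y * I) / 2)).re : ℂ) *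
      fordLaplace₀ f ((s + δ) - ((((1 / 2 : ℝ)) : ℂ) + y * I)) := by
    have h1 := integrable_kadiriQ_vertical h (s := s + δ) hsδ (a := 1 / 2) (Or.inl rfl)
    refine h1.congr (ae_of_all _ fun y ↦ ?_)
    simp only
    rw [kadiriQ_right_line]
  have hint2 := (integrable_shiftG_integrand hδ hs).const_mul (f 0 : ℂ)
  simp_rw [hpt]
  rw [integral_add hint1 hint2, integral_const_mul, fordLaplace₀_expTwist]
  unfold shiftG
  ring

/-! ## The digamma identity on the strip `1/2 < Re s < 3/2 − δ` -/

/-- **The two expansions compared.** If `f(0) ≠ 0` and both `s` and `s + δ` lie in the range of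
the tree's Prop. 2.1 (`1/2 < Re s`, `Re s + δ < 3/2`, neither equal to `1`, `ζ ≠ 0` at both), then
`Re G_δ(s) = ½[Re ψ((s+δ)/2 + 1) − Re ψ(s/2 + 1)]`. [cite: Kadiri2005, Prop. 2.1] -/
theorem re_shiftG_eq_of_strip (h : IsSmoothedEFTest f p p' p'' x₀) (hf0 : f 0 ≠ 0) {δ : ℝ}
    (hδ : 0 ≤ δ) {s : ℂ} (hs : 1 / 2 < s.re) (hs' : s.re + δ < 3 / 2) (hs1 : s ≠ 1)
    (hs1' : s + δ ≠ 1) (hζ : riemannZeta s ≠ 0) (hζ' : riemannZeta (s + δ) ≠ 0) :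
    (shiftG δ s).re = ((digamma ((s + δ) / 2 + 1)).re - (digamma (s / 2 + 1)).re) / 2 := by
  have hsδ : 1 / 2 < (s + δ).re := by simp; linarith
  have hsδ' : (s + δ).re < 3 / 2 := by simpa using hs'
  have E₁ := re_fordK_eq_kadiri (h.expTwist δ) (s := s) hs (by linarith) hs1 hζ
  have E₂ := re_fordK_eq_kadiri h (s := s + δ) hsδ hsδ' hs1' hζ'
  rw [fordK_expTwist, expTwist_zero, fordLaplace_expTwist,
    show s - 1 + (δ : ℂ) = s + δ - 1 by ring] at E₁
  have hsum : ∑' ρ : RHWave0.riemannZetaNontrivialZeros,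
      (riemannZetaZeroOrder (ρ : ℂ) : ℝ) * (fordLaplace (expTwist f δ) (s - ρ)).re =
      ∑' ρ : RHWave0.riemannZetaNontrivialZeros,
        (riemannZetaZeroOrder (ρ : ℂ) : ℝ) * (fordLaplace f (s + δ - ρ)).re := by
    refine tsum_congr fun ρ ↦ ?_
    rw [fordLaplace_expTwist, show s - (ρ : ℂ) + δ = s + δ - ρ by ring]
  have hT2 := congrArg Complex.re (T2_expTwist h hδ hs)
  simp only [Complex.add_re, Complex.re_ofReal_mul] at hT2
  simp only [Complex.add_re] at E₁ E₂
  rw [hsum] at E₁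
  have key : f 0 * ((shiftG δ s).re -
      (((digamma ((s + δ) / 2 + 1)).re - (digamma (s / 2 + 1)).re) / 2)) = 0 := by
    linarith
  rcases mul_eq_zero.1 key with h0 | h0
  · exact absurd h0 hf0
  · linarith

/-! ## Analyticity of `G_δ` on `Re s > 1/2` -/

/-- The weight `y ↦ Re ψ((1/2 + iy)/2)` is continuous. [folklore] -/
theorem continuous_re_digamma_half_line :
    Continuous fun y : ℝ ↦ ((digamma (((((1 / 2 : ℝ)) : ℂ) + y * I) / 2)).re : ℂ) := by
  refine Complex.continuous_ofReal.comp (Complex.continuous_re.comp ?_)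
  set g : ℝ → ℂ := fun y ↦ ((((1 / 2 : ℝ)) : ℂ) + y * I) / 2 with hg
  have hgc : Continuous g := by rw [hg]; fun_prop
  have e : (fun y : ℝ ↦ digamma (((((1 / 2 : ℝ)) : ℂ) + y * I) / 2)) = digamma ∘ g := rfl
  rw [e]
  refine continuous_iff_continuousAt.2 fun y ↦ ?_
  exact (differentiableAt_digamma (z := g y) (by simp [hg])).continuousAt.comp hgc.continuousAt

/-- The kernel `s ↦ 1/(s + c − w_y)` (`Re(s + c) > 1/2`): value continuous in `y`, and derivative
`−1/(s + c − w_y)²` in `s`. [folklore] -/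
theorem hasDerivAt_inv_sub_line {c : ℝ} {s : ℂ} (hs : 1 / 2 < s.re + c) (y : ℝ) :
    HasDerivAt (fun s : ℂ ↦ 1 / (s + c - ((((1 / 2 : ℝ)) : ℂ) + y * I)))
      (-1 / (s + c - ((((1 / 2 : ℝ)) : ℂ) + y * I)) ^ 2) s := by
  have hne : s + c - ((((1 / 2 : ℝ)) : ℂ) + y * I) ≠ 0 := fun e ↦ by
    have := congrArg Complex.re e; simp at this; linarith
  have h1 : HasDerivAt (fun s : ℂ ↦ s + c - ((((1 / 2 : ℝ)) : ℂ) + y * I)) 1 s :=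
    ((hasDerivAt_id s).add_const (c : ℂ)).sub_const _
  have h2 := h1.inv hne
  have e : (fun s : ℂ ↦ 1 / (s + c - ((((1 / 2 : ℝ)) : ℂ) + y * I))) =
      fun s ↦ (s + c - ((((1 / 2 : ℝ)) : ℂ) + y * I))⁻¹ := funext fun _ ↦ one_div _
  rw [e]
  exact h2

/-- **`G_δ` is complex-differentiable on `Re s > 1/2`** (differentiation under the integral sign,
dominated by `(log(3+|y|) + 12) · 16/((Re s₀ − ½)² + (Im s₀ − y)²)` on a ball around `s₀`).
[folklore] -/
theorem differentiableOn_shiftG {δ : ℝ} (hδ : 0 ≤ δ) :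
    DifferentiableOn ℂ (shiftG δ) {s : ℂ | 1 / 2 < s.re} := by
  intro s₀ hs₀
  simp only [mem_setOf_eq] at hs₀
  refine DifferentiableAt.differentiableWithinAt ?_
  unfold shiftG
  have hs₀0 : s₀ ≠ 0 := fun e ↦ by rw [e] at hs₀; simp at hs₀; linarith
  have hs₀δ : s₀ + δ ≠ 0 := fun e ↦ by
    have := congrArg Complex.re e; simp at this; linarith
  have hid : DifferentiableAt ℂ (fun s : ℂ ↦ s) s₀ := differentiableAt_id
  have hd1 : DifferentiableAt ℂ (fun s : ℂ ↦ 1 / (s + δ)) s₀ :=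
    (differentiableAt_const (1 : ℂ)).div (hid.add_const (δ : ℂ)) hs₀δ
  have hd2 : DifferentiableAt ℂ (fun s : ℂ ↦ 1 / s) s₀ := (differentiableAt_const (1 : ℂ)).div hid hs₀0
  have hrat : DifferentiableAt ℂ (fun s : ℂ ↦ 1 / (s + δ) - 1 / s) s₀ := hd1.sub hd2
  suffices hI : DifferentiableAt ℂ (fun s : ℂ ↦ ∫ y : ℝ,
      ((digamma (((((1 / 2 : ℝ)) : ℂ) + y * I) / 2)).re : ℂ) *
        (1 / (s + δ - ((((1 / 2 : ℝ)) : ℂ) + y * I)) - 1 / (s - ((((1 / 2 : ℝ)) : ℂ) + y * I)))) s₀ from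
    hrat.add (hI.const_mul _)
  -- the parametric integral
  set ε : ℝ := (s₀.re - 1 / 2) / 2 with hε
  have hε0 : 0 < ε := by rw [hε]; linarith
  set φ : ℝ → ℂ := fun y ↦ ((digamma (((((1 / 2 : ℝ)) : ℂ) + y * I) / 2)).re : ℂ) with hφ
  set w : ℝ → ℂ := fun y ↦ ((((1 / 2 : ℝ)) : ℂ) + y * I) with hw
  set F : ℂ → ℝ → ℂ := fun s y ↦ φ y * (1 / (s + δ - w y) - 1 / (s - w y)) with hF
  set F' : ℂ → ℝ → ℂ := fun s y ↦ φ y * (-1 / (s + δ - w y) ^ 2 - -1 / (s - w y) ^ 2) with hF'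
  set bound : ℝ → ℝ := fun y ↦ (Real.log (3 + |y|) + 12) * (16 / ((2 * ε) ^ 2 + (s₀.im - y) ^ 2))
    with hbound
  have hball_re : ∀ s ∈ Metric.ball s₀ ε, 1 / 2 + ε < s.re := by
    intro s hs
    have h1 : |s.re - s₀.re| < ε := by
      have := Complex.abs_re_le_norm (s - s₀)
      rw [Complex.sub_re] at this
      exact this.trans_lt (by simpa [dist_eq_norm] using hs)
    have := (abs_lt.1 h1).1
    rw [hε] at this ⊢; linarith
  have hball_im : ∀ s ∈ Metric.ball s₀ ε, |s.im - s₀.im| < ε := by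
    intro s hs
    have := Complex.abs_im_le_norm (s - s₀)
    rw [Complex.sub_im] at this
    exact this.trans_lt (by simpa [dist_eq_norm] using hs)
  -- continuity in `y` of `F s` and `F' s` for `Re s > 1/2`
  have hden : ∀ {s : ℂ} (c : ℝ), 1 / 2 < s.re + c → ∀ y : ℝ, s + c - w y ≠ 0 := by
    intro s c hsc y e
    have := congrArg Complex.re e; simp [hw] at this; linarith
  have hcontF : ∀ s : ℂ, 1 / 2 < s.re → Continuous (F s) := by
    intro s hs
    have h1 : Continuous fun y ↦ 1 / (s + δ - w y) :=
      Continuous.div continuous_const (by simp only [hw]; fun_prop) (hden δ (by linarith))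
    have h2 : Continuous fun y ↦ 1 / (s - w y) := by
      have := hden (s := s) 0 (by simpa using hs)
      simp only [Complex.ofReal_zero, add_zero] at this
      exact Continuous.div continuous_const (by simp only [hw]; fun_prop) this
    simp only [hF]
    exact continuous_re_digamma_half_line.mul (h1.sub h2)
  have hcontF' : ∀ s : ℂ, 1 / 2 < s.re → Continuous (F' s) := by
    intro s hs
    have h1 : Continuous fun y ↦ -1 / (s + δ - w y) ^ 2 :=
      Continuous.div continuous_const (by simp only [hw]; fun_prop)
        (fun y ↦ pow_ne_zero 2 (hden δ (by linarith) y))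
    have h2 : Continuous fun y ↦ -1 / (s - w y) ^ 2 := by
      have := hden (s := s) 0 (by simpa using hs)
      simp only [Complex.ofReal_zero, add_zero] at this
      exact Continuous.div continuous_const (by simp only [hw]; fun_prop) (fun y ↦ pow_ne_zero 2 (this y))
    simp only [hF']
    exact continuous_re_digamma_half_line.mul (h1.sub h2)
  have key := hasDerivAt_integral_of_dominated_loc_of_deriv_le (μ := volume) (F := F) (F' := F')
    (x₀ := s₀) (bound := bound) (Metric.ball_mem_nhds s₀ hε0) ?_ ?_ ?_ ?_ ?_ ?_
  · simpa only [hF, hφ, hw] using key.2.differentiableAt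
  · -- measurability of `F s` near `s₀`
    refine eventually_of_mem (Metric.ball_mem_nhds s₀ hε0) fun s hs ↦ ?_
    exact (hcontF s (by linarith [hball_re s hs])).aestronglyMeasurable
  · -- integrability at `s₀`
    simp only [hF, hφ, hw]
    exact integrable_shiftG_integrand hδ hs₀
  · exact (hcontF' s₀ hs₀).aestronglyMeasurable
  · -- the bound on the ball
    refine ae_of_all _ fun y s hs ↦ ?_
    have hsre := hball_re s hs
    have hsim := hball_im s hs
    have hq : (2 * ε) ^ 2 + (s₀.im - y) ^ 2 ≤ 8 * ((s.re - 1 / 2) ^ 2 + (s.im - y) ^ 2) := by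
      have h1 : ε ≤ s.re - 1 / 2 := by linarith
      have h2 : (s₀.im - y) ^ 2 ≤ 2 * (s.im - y) ^ 2 + 2 * (s.im - s₀.im) ^ 2 := by
        nlinarith [sq_nonneg ((s₀.im - y) - 2 * (s.im - y)), sq_nonneg (s.im - s₀.im + (s.im - y) - (s₀.im - y))]
      have h3 : (s.im - s₀.im) ^ 2 < ε ^ 2 := by
        have := abs_lt.1 hsim; nlinarith
      nlinarith
    have hz2 : ∀ c : ℝ, 0 ≤ c → (s.re - 1 / 2) ^ 2 + (s.im - y) ^ 2 ≤ ‖s + c - w y‖ ^ 2 := by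
      intro c hc
      rw [Complex.sq_norm, Complex.normSq_apply]
      simp [hw]
      nlinarith
    have hq0 : 0 < (s.re - 1 / 2) ^ 2 + (s.im - y) ^ 2 := by nlinarith
    have hnorm1 : ‖-1 / (s + δ - w y) ^ 2‖ ≤ 1 / ((s.re - 1 / 2) ^ 2 + (s.im - y) ^ 2) := by
      rw [norm_div, norm_neg, norm_one, norm_pow]
      exact one_div_le_one_div_of_le hq0 (hz2 δ hδ)
    have hnorm2 : ‖-1 / (s - w y) ^ 2‖ ≤ 1 / ((s.re - 1 / 2) ^ 2 + (s.im - y) ^ 2) := by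
      rw [norm_div, norm_neg, norm_one, norm_pow]
      have := hz2 0 le_rfl
      simp only [Complex.ofReal_zero, add_zero] at this
      exact one_div_le_one_div_of_le hq0 this
    have hφle : ‖φ y‖ ≤ Real.log (3 + |y|) + 12 := by
      simp only [hφ, Complex.norm_real, Real.norm_eq_abs]
      exact KadiriGamma.abs_re_digamma_le y
    have hφ0 : 0 ≤ Real.log (3 + |y|) + 12 := by
      have := Real.log_nonneg (by linarith [abs_nonneg y] : (1 : ℝ) ≤ 3 + |y|); linarith
    simp only [hF', hbound]
    rw [norm_mul]
    refine mul_le_mul hφle ?_ (norm_nonneg _) hφ0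
    calc ‖-1 / (s + δ - w y) ^ 2 - -1 / (s - w y) ^ 2‖
        ≤ ‖-1 / (s + δ - w y) ^ 2‖ + ‖-1 / (s - w y) ^ 2‖ := norm_sub_le _ _
      _ ≤ 2 / ((s.re - 1 / 2) ^ 2 + (s.im - y) ^ 2) := by
          have e : 2 / ((s.re - 1 / 2) ^ 2 + (s.im - y) ^ 2) = 1 / ((s.re - 1 / 2) ^ 2 + (s.im - y) ^ 2) +
              1 / ((s.re - 1 / 2) ^ 2 + (s.im - y) ^ 2) := by ring
          rw [e]; exact add_le_add hnorm1 hnorm2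
      _ ≤ 16 / ((2 * ε) ^ 2 + (s₀.im - y) ^ 2) := by
          rw [div_le_div_iff₀ hq0 (by positivity)]
          nlinarith
  · -- integrability of the bound
    simp only [hbound]
    exact KadiriGamma.integrable_T2_majorant (t := s₀.im) (by positivity) (by norm_num) (by norm_num)
  · -- differentiability in `s`
    refine ae_of_all _ fun y s hs ↦ ?_
    have hsre := hball_re s hs
    simp only [hF, hF']
    refine HasDerivAt.const_mul _ (HasDerivAt.sub ?_ ?_)
    · exact hasDerivAt_inv_sub_line (c := δ) (by linarith) y
    · have := hasDerivAt_inv_sub_line (c := 0) (s := s) (by simpa using (by linarith : 1 / 2 < s.re)) y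
      simp only [Complex.ofReal_zero, add_zero] at this
      simpa only [hw] using this

/-- `G_δ` is analytic on the half-plane `Re s > 1/2`. [folklore] -/
theorem analyticOnNhd_shiftG {δ : ℝ} (hδ : 0 ≤ δ) :
    AnalyticOnNhd ℂ (shiftG δ) {s : ℂ | 1 / 2 < s.re} :=
  (differentiableOn_shiftG hδ).analyticOnNhd (isOpen_lt continuous_const Complex.continuous_re)

/-- `s ↦ ½[ψ((s+δ)/2 + 1) − ψ(s/2 + 1)]` is analytic on `Re s > 1/2` (`δ ≥ 0`). [folklore] -/
theorem analyticOnNhd_digamma_shift {δ : ℝ} (hδ : 0 ≤ δ) :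
    AnalyticOnNhd ℂ (fun s : ℂ ↦ (digamma ((s + δ) / 2 + 1) - digamma (s / 2 + 1)) / 2)
      {s : ℂ | 1 / 2 < s.re} := by
  refine DifferentiableOn.analyticOnNhd (fun s hs ↦ ?_) (isOpen_lt continuous_const Complex.continuous_re)
  simp only [mem_setOf_eq] at hs
  refine DifferentiableAt.differentiableWithinAt ?_
  refine DifferentiableAt.div_const (DifferentiableAt.sub ?_ ?_) _
  · have hd := differentiableAt_digamma (z := (s + δ) / 2 + 1) (by simp; linarith)
    exact hd.comp s (((differentiableAt_id.add_const _).div_const _).add_const _)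
  · have hd := differentiableAt_digamma (z := s / 2 + 1) (by simp; linarith)
    exact hd.comp s ((differentiableAt_id.div_const _).add_const _)

/-! ## Vanishing real part propagates (open mapping + identity theorem) -/

/-- If `Φ` is analytic on a preconnected open set `U` and `Re Φ = 0` on a non-empty open subset
`V`, then `Re Φ = 0` on `U` (on `V` the map `Φ` is not open, hence locally constant by the open
mapping theorem; then constant on `U` by the identity theorem). [folklore] -/
theorem re_eq_zero_of_re_eq_zero_on_open {U V : Set ℂ} (hUc : IsPreconnected U)
    {Φ : ℂ → ℂ} (hΦ : AnalyticOnNhd ℂ Φ U) (hV : IsOpen V) (hVU : V ⊆ U) {z₀ : ℂ} (hz₀ : z₀ ∈ V)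
    (h0 : ∀ z ∈ V, (Φ z).re = 0) {z : ℂ} (hz : z ∈ U) : (Φ z).re = 0 := by
  rcases (hΦ z₀ (hVU hz₀)).eventually_constant_or_nhds_le_map_nhds with hc | hopen
  · -- locally constant ⇒ constant on `U`
    have heq : EqOn Φ (fun _ ↦ Φ z₀) U :=
      hΦ.eqOn_of_preconnected_of_eventuallyEq analyticOnNhd_const hUc (hVU hz₀) hc
    rw [heq hz]
    exact h0 z₀ hz₀
  · -- the open-mapping alternative contradicts `Φ(V) ⊆ iℝ`
    exfalso
    have hpre : {w : ℂ | w.re = 0} ∈ 𝓝 (Φ z₀) := by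
      apply hopen
      rw [Filter.mem_map]
      exact mem_of_superset (hV.mem_nhds hz₀) fun z hz ↦ h0 z hz
    obtain ⟨r, hr, hball⟩ := Metric.mem_nhds_iff.1 hpre
    have hmem : Φ z₀ + (r / 2 : ℝ) ∈ Metric.ball (Φ z₀) r := by
      rw [Metric.mem_ball, dist_eq_norm]
      simp [abs_of_pos hr]
      linarith
    have := hball hmem
    simp only [mem_setOf_eq, Complex.add_re, Complex.ofReal_re, h0 z₀ hz₀] at this
    linarith

/-! ## The digamma identity on the half-plane, and the formula at `s + δ` -/

/-- No zero of `ζ` has `1/2 < Re s` and `1 < Im s < 2` (non-trivial zeros have `|Im| > 14`, and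
`ζ ≠ 0` on `Re s ≥ 1`). [folklore] -/
theorem riemannZeta_ne_zero_of_small_im {s : ℂ} (hs : 1 / 2 < s.re) (h1 : 1 < s.im) (h2 : s.im < 2) :
    riemannZeta s ≠ 0 := by
  intro hz
  rcases le_or_gt 1 s.re with hre | hre
  · exact riemannZeta_ne_zero_of_one_le_re hre hz
  · have hmem := ZetaZeros.riemannZetaNontrivialZeros.mem_of_im_ne_zero hz (by linarith : s.im ≠ 0)
    have h14 := FordL33.fourteen_lt_abs_im ⟨s, hmem⟩
    simp only at h14
    rw [abs_of_pos (by linarith : 0 < s.im)] at h14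
    linarith

/-- **The digamma identity** `Re G_δ(s) = ½[Re ψ((s+δ)/2+1) − Re ψ(s/2+1)]` on the whole
half-plane `Re s > 1/2` (`0 ≤ δ < 1`). [cite: Kadiri2005, Prop. 2.1] -/
theorem re_shiftG_eq {δ : ℝ} (hδ : 0 ≤ δ) (hδ1 : δ < 1) {s : ℂ} (hs : 1 / 2 < s.re) :
    (shiftG δ s).re = ((digamma ((s + δ) / 2 + 1)).re - (digamma (s / 2 + 1)).re) / 2 := by
  -- an admissible test function with `f(0) ≠ 0`
  have hθ : (0 : ℝ) < 1 := one_pos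
  have hθ' : (1 : ℝ) < π / 2 := by have := Real.pi_gt_three; linarith
  have hT := KadiriTest.isSmoothedEFTest hθ hθ' one_pos
  have hf0 : kadiriTest 1 1 0 ≠ 0 := by
    rw [KadiriTest.map_zero hθ hθ']; have := fordSmoothW0_pos hθ hθ'; positivity
  set U : Set ℂ := {s : ℂ | 1 / 2 < s.re} with hU
  set V : Set ℂ := {s : ℂ | 1 / 2 < s.re ∧ s.re < 3 / 2 - δ ∧ 1 < s.im ∧ s.im < 2} with hV
  set Φ : ℂ → ℂ := fun s ↦ shiftG δ s - (digamma ((s + δ) / 2 + 1) - digamma (s / 2 + 1)) / 2 with hΦ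
  have hUc : IsPreconnected U := (convex_halfSpace_re_gt (1 / 2 : ℝ)).isPreconnected
  have hΦa : AnalyticOnNhd ℂ Φ U := (analyticOnNhd_shiftG hδ).sub (analyticOnNhd_digamma_shift hδ)
  have hVo : IsOpen V := by
    simp only [hV, setOf_and]
    exact (isOpen_lt continuous_const Complex.continuous_re).inter
      ((isOpen_lt Complex.continuous_re continuous_const).inter
      ((isOpen_lt continuous_const Complex.continuous_im).inter
      (isOpen_lt Complex.continuous_im continuous_const)))
  have hVU : V ⊆ U := fun z hz ↦ hz.1
  set z₀ : ℂ := ((1 - δ / 2 : ℝ) : ℂ) + (3 / 2 : ℝ) * I with hz₀def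
  have hz₀ : z₀ ∈ V := by
    simp only [hV, hz₀def, mem_setOf_eq]
    norm_num
    refine ⟨by linarith, by linarith⟩
  have hre0 : ∀ z ∈ V, (Φ z).re = 0 := by
    intro z hz
    obtain ⟨hz1, hz2, hz3, hz4⟩ := hz
    have hne1 : z ≠ 1 := fun e ↦ by rw [e] at hz3; norm_num at hz3
    have hne1' : z + δ ≠ 1 := fun e ↦ by
      have := congrArg Complex.im e; simp at this; linarith
    have hζ := riemannZeta_ne_zero_of_small_im hz1 hz3 hz4
    have hζ' : riemannZeta (z + δ) ≠ 0 :=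
      riemannZeta_ne_zero_of_small_im (s := z + δ) (by simp; linarith) (by simpa using hz3)
        (by simpa using hz4)
    have key := re_shiftG_eq_of_strip hT hf0 hδ hz1 (by linarith) hne1 hne1' hζ hζ'
    simp only [hΦ, Complex.sub_re, Complex.div_ofNat_re, key]
    ring
  have := re_eq_zero_of_re_eq_zero_on_open hUc hΦa hVo hVU hz₀ hre0 (z := s) hs
  simp only [hΦ, Complex.sub_re, Complex.div_ofNat_re] at this
  linarith

/-- **Kadiri's Prop. 2.1 at the shifted point `s + δ`** (real-part form, zeros with
multiplicity): for an admissible `f`, `0 ≤ δ < 1`, `1/2 < Re s < 3/2`, `s ≠ 1`, `ζ(s) ≠ 0`,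
`Re K_f(s+δ) = f(0)(−½log π + ½Re ψ((s+δ)/2+1)) + Re F(s+δ−1) − Σ_ρ m(ρ) Re F(s+δ−ρ) + T₂(s+δ)`,
with `T₂` the `Γ`-remainder written at the point `s + δ`. [cite: Kadiri2005, Prop. 2.1] -/
theorem re_fordK_eq_kadiri_shift (h : IsSmoothedEFTest f p p' p'' x₀) {δ : ℝ} (hδ : 0 ≤ δ)
    (hδ1 : δ < 1) {s : ℂ} (hσ₁ : 1 / 2 < s.re) (hσ₂ : s.re < 3 / 2) (hs1 : s ≠ 1)
    (hζs : riemannZeta s ≠ 0) :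
    (fordK f (s + δ)).re = f 0 * (-(Real.log π) / 2 + (digamma ((s + δ) / 2 + 1)).re / 2) +
      (fordLaplace f (s + δ - 1)).re -
      ∑' ρ : RHWave0.riemannZetaNontrivialZeros,
        (riemannZetaZeroOrder (ρ : ℂ) : ℝ) * (fordLaplace f (s + δ - ρ)).re +
      (fordLaplace₀ f (s + δ) + (1 / (2 * π) : ℂ) *
        ∫ y : ℝ, ((digamma (((((1 / 2 : ℝ)) : ℂ) + y * I) / 2)).re : ℂ) *
          fordLaplace₀ f ((s + δ) - ((((1 / 2 : ℝ)) : ℂ) + y * I))).re := by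
  have E₁ := re_fordK_eq_kadiri (h.expTwist δ) (s := s) hσ₁ hσ₂ hs1 hζs
  rw [fordK_expTwist, expTwist_zero, fordLaplace_expTwist,
    show s - 1 + (δ : ℂ) = s + δ - 1 by ring] at E₁
  have hsum : ∑' ρ : RHWave0.riemannZetaNontrivialZeros,
      (riemannZetaZeroOrder (ρ : ℂ) : ℝ) * (fordLaplace (expTwist f δ) (s - ρ)).re =
      ∑' ρ : RHWave0.riemannZetaNontrivialZeros,
        (riemannZetaZeroOrder (ρ : ℂ) : ℝ) * (fordLaplace f (s + δ - ρ)).re := by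
    refine tsum_congr fun ρ ↦ ?_
    rw [fordLaplace_expTwist, show s - (ρ : ℂ) + δ = s + δ - ρ by ring]
  have hT2 := congrArg Complex.re (T2_expTwist h hδ hσ₁)
  simp only [Complex.add_re, Complex.re_ofReal_mul] at hT2
  have hG := re_shiftG_eq hδ hδ1 hσ₁
  simp only [Complex.add_re] at E₁ ⊢
  rw [hsum, hT2, hG] at E₁
  linarith

end SmoothedEF

end Literature.NumberTheory.LFunctions
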